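import Summits.ValiantsHypothesis.ValiantsHypothesis.Theorems.BarrierLeverChowBenchmarkPairsCrowding

/-!
# Route BarrierLever — item 22038 `ChowBenchmarkPairs`, line `moore-peel`: the AXIS-POINT no-go — a point on a coordinate axis `ℂ·e_c`
# needs at least `h` benchmark columns through the bit `c`

Helper file (`--supports stmt-ValiantsHypothesis-22038`; cell valiant-natproofs, rung V4, 𝒟-side benchmark of record; seat val-np-p4 gen 20;
companion of `…Crowding` (p636017)).  Closes NO item; definition-free.

THE RULE (design rule R7, the general-table form of the "top-point" count of MEMO-g18-v5 §5 / g18-memo §5).  If some point of the table lies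
on a coordinate axis, `P s = λ·e_c` (any `λ`), and fewer than `h` benchmark columns contain the bit `c` (`N_c < h`), the segment-moment matrix
is singular (`det_segMatrix_eq_zero_of_axis_point`, `det_eq_zero_of_axis_point`).  MECHANISM: `R_s = 1 + λ y_c` exactly (`y_c² = 0`), so
`row{s,b} − row{b} = λ·y_c R_b` and `row{s} − row ∅ = λ·y_c` — `h` independent row combinations supported on the `N_c` columns through `c`
(`pairSum_axis`).  With `c` the top bit this is the count `N_top ≥ h` that singles out the Ramanujan–Nagell heights for the pure top-bit step;
in the g20 0/1 census it is the rule 'R7' (364 of the 1 165 singular designs at h = 4).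

WHAT THIS IS NOT: a constraint on witnesses of the ∀h stubs only; no stub of the line is closed; nothing on items 20172 / 19717, crux
stmt-ValiantsHypothesis-14610, or `VP` versus `VNP`.
-/

set_option linter.dupNamespace false

namespace Summit.ValiantsHypothesis.ValiantsHypothesis.Theorems.BarrierLever.ChowBenchmarkHyperplane

open Finset Module
open Summit.ValiantsHypothesis.ValiantsHypothesis.Theorems.BarrierLever.MoorePeel (benchCols)

variable {h : ℕ}

noncomputable section

/-! ## 1. Pair rows against an axis point -/

/-- A product of coordinates of the axis point `λ e_c` over a set with an element `≠ c` vanishes. -/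
theorem prod_axis_eq_zero (P : Fin h → Fin h → ℂ) {s c : Fin h} {lam : ℂ} (hs : ∀ x, P s x = if x = c then lam else 0)
    {d : Finset (Fin h)} {x : Fin h} (hx : x ∈ d) (hxc : x ≠ c) : ∏ y ∈ d, P s y = 0 :=
  Finset.prod_eq_zero hx (by rw [hs x, if_neg hxc])

/-- **Pair row `{λe_c, b}`**: `pairSum P s b T = |T|!·∏_{x∈T} P b x + [c ∈ T]·λ·(|T|−1)!·∏_{x∈T∖c} P b x`. -/
theorem pairSum_axis (P : Fin h → Fin h → ℂ) {s c : Fin h} {lam : ℂ} (hs : ∀ x, P s x = if x = c then lam else 0) (b : Fin h)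
    (T : Finset (Fin h)) :
    pairSum P s b T = (T.card.factorial : ℂ) * ∏ x ∈ T, P b x +
      (if c ∈ T then lam * ((((T.card - 1).factorial : ℕ) : ℂ) * ∏ x ∈ T.erase c, P b x) else 0) := by
  classical
  unfold pairSum
  by_cases hcT : c ∈ T
  · rw [if_pos hcT]
    obtain ⟨T', hcT', rfl⟩ : ∃ T' : Finset (Fin h), c ∉ T' ∧ T = insert c T' :=
      ⟨T.erase c, Finset.notMem_erase c T, (Finset.insert_erase hcT).symm⟩
    rw [Finset.sum_powerset_insert hcT', Finset.erase_insert hcT', Finset.card_insert_of_notMem hcT', Nat.add_sub_cancel]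
    have h1 : ∑ d ∈ T'.powerset, (d.card.factorial : ℂ) * (((insert c T') \ d).card.factorial : ℂ) *
        ((∏ x ∈ d, P s x) * ∏ x ∈ (insert c T') \ d, P b x) =
        ((T'.card + 1).factorial : ℂ) * ∏ x ∈ insert c T', P b x := by
      rw [Finset.sum_eq_single_of_mem ∅ (Finset.empty_mem_powerset T')]
      · simp [Finset.card_insert_of_notMem hcT']
      · intro d hd hne
        obtain ⟨x, hx⟩ := Finset.nonempty_iff_ne_empty.mpr hne
        have hxc : x ≠ c := fun e => hcT' (e ▸ Finset.mem_powerset.mp hd hx)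
        rw [prod_axis_eq_zero P hs hx hxc, zero_mul, mul_zero]
    have h2 : ∑ d ∈ T'.powerset, ((insert c d).card.factorial : ℂ) * (((insert c T') \ insert c d).card.factorial : ℂ) *
        ((∏ x ∈ insert c d, P s x) * ∏ x ∈ (insert c T') \ insert c d, P b x) =
        lam * (((T'.card.factorial : ℕ) : ℂ) * ∏ x ∈ T', P b x) := by
      rw [Finset.sum_eq_single_of_mem ∅ (Finset.empty_mem_powerset T')]
      · have e2 : insert c T' \ ({c} : Finset (Fin h)) = T' := by
          rw [Finset.insert_sdiff_of_mem _ (Finset.mem_singleton_self c), Finset.sdiff_singleton_eq_erase]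
          exact Finset.erase_eq_of_notMem hcT'
        simp [hs, e2]
        ring
      · intro d hd hne
        obtain ⟨x, hx⟩ := Finset.nonempty_iff_ne_empty.mpr hne
        have hxc : x ≠ c := fun e => hcT' (e ▸ Finset.mem_powerset.mp hd hx)
        rw [prod_axis_eq_zero P hs (Finset.mem_insert_of_mem hx) hxc, zero_mul, mul_zero]
    rw [h1, h2]
  · rw [if_neg hcT, add_zero, Finset.sum_eq_single_of_mem ∅ (Finset.empty_mem_powerset T)]
    · simp
    · intro d hd hne
      obtain ⟨x, hx⟩ := Finset.nonempty_iff_ne_empty.mpr hne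
      have hxc : x ≠ c := fun e => hcT (e ▸ Finset.mem_powerset.mp hd hx)
      rw [prod_axis_eq_zero P hs hx hxc, zero_mul, mul_zero]

/-- Off the columns through `c`, the pair row `{s, b}` coincides with the singleton row `{b}`. -/
theorem pairSum_axis_sub_single (P : Fin h → Fin h → ℂ) {s c : Fin h} {lam : ℂ} (hs : ∀ x, P s x = if x = c then lam else 0)
    (b : Fin h) {T : Finset (Fin h)} (hcT : c ∉ T) :
    pairSum P s b T - (T.card.factorial : ℂ) * ∏ x ∈ T, P b x = 0 := by
  rw [pairSum_axis P hs b T, if_neg hcT, add_zero, sub_self]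

/-- Off the columns through `c`, the singleton row `{s}` coincides with the row `∅`. -/
theorem single_axis_sub_empty (P : Fin h → Fin h → ℂ) {s c : Fin h} {lam : ℂ} (hs : ∀ x, P s x = if x = c then lam else 0)
    {T : Finset (Fin h)} (hcT : c ∉ T) :
    (T.card.factorial : ℂ) * ∏ x ∈ T, P s x - (if T = ∅ then 1 else 0) = 0 := by
  classical
  by_cases hT : T = ∅
  · subst hT; simp
  · obtain ⟨x, hx⟩ := Finset.nonempty_iff_ne_empty.mpr hT
    have hxc : x ≠ c := fun e => hcT (e ▸ hx)
    rw [if_neg hT, prod_axis_eq_zero P hs hx hxc, mul_zero, sub_zero]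

/-! ## 2. The no-go -/

/-- **An axis point with too few columns through its axis kills the table (matrix form).**  If `P s = λ e_c` and fewer than `h` benchmark
columns contain the bit `c`, then for every enumeration `uu` hitting all sets of size `≤ 2` the segment-moment matrix has determinant `0`. -/
theorem det_segMatrix_eq_zero_of_axis_point {r : ℕ} (P : Fin h → Fin h → ℂ) (s c : Fin h) (lam : ℂ)
    (hs : ∀ x, P s x = if x = c then lam else 0)
    (hN : (Finset.univ.filter fun j : Fin r => c ∈ benchCols h r j).card < h)
    (uu : Fin r → Finset (Fin h)) (hsurj : ∀ S : Finset (Fin h), S.card ≤ 2 → ∃ i, uu i = S) :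
    (segMatrix r P uu).det = 0 := by
  classical
  set M := segMatrix r P uu with hM
  have card2 : ∀ p q : Fin h, p ≠ q → ({p, q} : Finset (Fin h)).card ≤ 2 := fun p q hpq => by rw [Finset.card_pair hpq]
  obtain ⟨i0, hi0⟩ := hsurj ∅ (by simp)
  have hib : ∀ b : Fin h, ∃ i, uu i = {b} := fun b => hsurj {b} (by simp)
  choose ib hib using hib
  have hip' : ∀ b : Fin h, ∃ i, s ≠ b → uu i = {s, b} := by
    intro b
    by_cases hne : s ≠ b
    · obtain ⟨i, hi⟩ := hsurj _ (card2 s b hne); exact ⟨i, fun _ => hi⟩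
    · exact ⟨i0, fun h' => absurd h' hne⟩
  choose ip hip' using hip'
  -- the h combinations: w b = row{s,b} − row{b} (b ≠ s), w s = row{s} − row ∅
  let w : Fin h → (Fin r → ℂ) := fun b =>
    if b = s then Pi.single (ib s) (1 : ℂ) - Pi.single i0 (1 : ℂ) else Pi.single (ip b) (1 : ℂ) - Pi.single (ib b) (1 : ℂ)
  have hw : ∀ b : Fin h, ∀ j : Fin r, c ∉ benchCols h r j → Matrix.vecMul (w b) M j = 0 := by
    intro b j hcj
    by_cases hb : b = s
    · simp only [w, if_pos hb, Matrix.sub_vecMul, Matrix.single_one_vecMul, Pi.sub_apply, Matrix.row_apply]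
      have e1 := congr_fun (segMatrix_row_singleton P uu (hib s)) j
      have e0 := congr_fun (segMatrix_row_empty P uu hi0) j
      rw [Matrix.row_apply] at e1 e0
      rw [hM, e1, e0]
      exact single_axis_sub_empty P hs hcj
    · simp only [w, if_neg hb, Matrix.sub_vecMul, Matrix.single_one_vecMul, Pi.sub_apply, Matrix.row_apply]
      have e1 := congr_fun (segMatrix_row_singleton P uu (hib b)) j
      rw [Matrix.row_apply] at e1
      rw [hM, e1, segMatrix_row_pair P uu (Ne.symm hb) (hip' b (Ne.symm hb)) j]
      exact pairSum_axis_sub_single P hs b hcj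
  -- the crowded map
  let J : Type := {j : Fin r // c ∈ benchCols h r j}
  let Wm : Matrix (Fin h) (Fin r) ℂ := fun b i => w b i
  let Φ : (Fin h → ℂ) →ₗ[ℂ] (J → ℂ) :=
    { toFun := fun μ j => Matrix.vecMul (Matrix.vecMul μ Wm) M j.1
      map_add' := fun μ ν => by
        funext j; simp only [Matrix.add_vecMul, Pi.add_apply]
      map_smul' := fun a μ => by
        funext j; simp only [Matrix.smul_vecMul, Pi.smul_apply, RingHom.id_apply] }
  have hdim : finrank ℂ (J → ℂ) < finrank ℂ (Fin h → ℂ) := by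
    rw [finrank_fintype_fun_eq_card, finrank_fintype_fun_eq_card, Fintype.card_fin, Fintype.card_subtype]
    exact hN
  obtain ⟨μ, hμker, hμ0⟩ : ∃ μ ∈ LinearMap.ker Φ, μ ≠ 0 :=
    Submodule.exists_mem_ne_zero_of_ne_bot (LinearMap.ker_ne_bot_of_finrank_lt hdim)
  let v : Fin r → ℂ := Matrix.vecMul μ Wm
  have hvM : Matrix.vecMul v M = 0 := by
    funext j
    by_cases hj : c ∈ benchCols h r j
    · exact congr_fun (LinearMap.mem_ker.mp hμker) ⟨j, hj⟩
    · show Matrix.vecMul (Matrix.vecMul μ Wm) M j = 0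
      have e : Matrix.vecMul (Matrix.vecMul μ Wm) M j = ∑ b : Fin h, μ b * Matrix.vecMul (w b) M j := by
        simp only [Matrix.vecMul, dotProduct, Wm, Finset.sum_mul, Finset.mul_sum, mul_assoc]
        rw [Finset.sum_comm]
      rw [e]
      exact Finset.sum_eq_zero fun b _ => by rw [hw b j hj, mul_zero]
  have hv0 : v ≠ 0 := by
    intro hv
    apply hμ0
    -- distinctness of the chosen indices
    have pair_ne_single : ∀ b b' : Fin h, s ≠ b → ip b ≠ ib b' := by
      intro b b' hne e
      have := (hip' b hne).symm.trans ((congrArg uu e).trans (hib b'))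
      have h1 : s ∈ ({b'} : Finset (Fin h)) := by rw [← this]; simp
      have h2 : b ∈ ({b'} : Finset (Fin h)) := by rw [← this]; simp
      rw [Finset.mem_singleton] at h1 h2
      exact hne (h1.trans h2.symm)
    have pair_ne_empty : ∀ b : Fin h, s ≠ b → ip b ≠ i0 := by
      intro b hne e
      have := (hip' b hne).symm.trans ((congrArg uu e).trans hi0)
      have h1 : s ∈ (∅ : Finset (Fin h)) := by rw [← this]; simp
      simp at h1
    have single_ne_empty : ∀ b : Fin h, ib b ≠ i0 := by
      intro b e
      have := (hib b).symm.trans ((congrArg uu e).trans hi0)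
      exact (Finset.singleton_ne_empty b) this
    have single_inj : ∀ b b' : Fin h, ib b = ib b' → b = b' := by
      intro b b' e
      exact Finset.singleton_injective ((hib b).symm.trans ((congrArg uu e).trans (hib b')))
    have pair_inj : ∀ b b' : Fin h, s ≠ b → s ≠ b' → ip b = ip b' → b = b' := by
      intro b b' hne hne' e
      have := (hip' b hne).symm.trans ((congrArg uu e).trans (hip' b' hne'))
      rcases pair_eq_pair_iff s b s b' this with ⟨_, h2⟩ | ⟨h1, _⟩
      · exact h2
      · exact absurd h1 hne'
    funext b
    by_cases hb : b = s
    · -- coordinate `ib s` is private to `w s`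
      have e : v (ib s) = μ s := by
        simp only [v, Matrix.vecMul, dotProduct, Wm, w]
        rw [Finset.sum_eq_single_of_mem s (Finset.mem_univ s)]
        · rw [if_pos rfl, Pi.sub_apply, Pi.single_eq_same, Pi.single_eq_of_ne (single_ne_empty s)]; ring
        · intro b' _ hb'
          rw [if_neg hb', Pi.sub_apply, Pi.single_eq_of_ne (Ne.symm (pair_ne_single b' s (Ne.symm hb'))),
            Pi.single_eq_of_ne (show ib s ≠ ib b' from fun e => hb' (single_inj _ _ e).symm)]
          ring
      have := congr_fun hv (ib s)
      rw [e] at this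
      rw [hb]; exact this
    · -- coordinate `ip b` is private to `w b`
      have e : v (ip b) = μ b := by
        simp only [v, Matrix.vecMul, dotProduct, Wm, w]
        rw [Finset.sum_eq_single_of_mem b (Finset.mem_univ b)]
        · rw [if_neg hb, Pi.sub_apply, Pi.single_eq_same,
            Pi.single_eq_of_ne (pair_ne_single b b (Ne.symm hb))]; ring
        · intro b' _ hb'
          by_cases hb's : b' = s
          · rw [if_pos hb's, Pi.sub_apply, Pi.single_eq_of_ne (pair_ne_single b s (Ne.symm hb)),
              Pi.single_eq_of_ne (pair_ne_empty b (Ne.symm hb))]; ring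
          · rw [if_neg hb's, Pi.sub_apply,
              Pi.single_eq_of_ne (fun e => hb' (pair_inj _ _ (Ne.symm hb) (Ne.symm hb's) e).symm),
              Pi.single_eq_of_ne (pair_ne_single b b' (Ne.symm hb))]; ring
      have := congr_fun hv (ip b)
      rw [e] at this
      exact this
  exact (Matrix.exists_vecMul_eq_zero_iff).mp ⟨v, hv0, hvM⟩

/-- **Axis points — the line's form.**  A table with a point on a coordinate axis `ℂ·e_c` through which fewer than `h` benchmark columns pass
is never a witness of `stub_segmentMeanValue` / `stub_s10` / `stub_zeroOneDesign`. -/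
theorem det_eq_zero_of_axis_point {r : ℕ} (P : Fin h → Fin h → ℂ) (s c : Fin h) (lam : ℂ)
    (hs : ∀ x, P s x = if x = c then lam else 0)
    (hN : (Finset.univ.filter fun j : Fin r => c ∈ benchCols h r j).card < h)
    (uu : Fin r → Finset (Fin h)) (hsurj : ∀ S : Finset (Fin h), S.card ≤ 2 → ∃ i, uu i = S) :
    (Matrix.of fun i j : Fin r =>
      ∑ g : (↥(benchCols h r j) → ↥(uu i)), (∏ c : ↥(benchCols h r j), P (g c) c) *
        ∏ a : ↥(uu i), ((Finset.univ.filter fun c : ↥(benchCols h r j) => g c = a).card.factorial : ℂ)).det = 0 :=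
  det_segMatrix_eq_zero_of_axis_point P s c lam hs hN uu hsurj

end

end Summit.ValiantsHypothesis.ValiantsHypothesis.Theorems.BarrierLever.ChowBenchmarkHyperplane
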